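import Summits.BirchSwinnertonDyer.Rank1Residual.Additive.X4ThreeResCertKernel
import Summits.BirchSwinnertonDyer.Rank1Residual.Additive.X4KimLargeImagePrimary
import Summits.BirchSwinnertonDyer.Rank1Residual.Additive.X4KimLargeImageIntegralPeriod
import Summits.BirchSwinnertonDyer.Rank1Residual.Additive.X4KimLargeImageKuriharaCertificate
import Summits.BirchSwinnertonDyer.Rank1Residual.Additive.X4SharpThreeKimConjectureEndState
import Summits.BirchSwinnertonDyer.Rank1Residual.Additive.X4SharpThreeKimLattice
import Summits.BirchSwinnertonDyer.Rank1Residual.GaloisImage.FrobeniusOrderWitness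
import Summits.BirchSwinnertonDyer.Rank1Residual.X4.OptimalPeriod
import Literature.NumberTheory.EllipticCurves.NonEisensteinPrimeOfSurjective
import HarnessLib

/-!
# N11 LOWER@3 rows: the KURIHARA-CERTIFICATE chain at `p = 3` FED BY KERNEL CERTIFICATES — Kolyvagin
# primes and cyclicity READ OFF POINT COUNTS of the integer model, the period / Manin binders from an
# OPTIMAL datum, `BSD(E,3)` from ONE non-vanishing Kurihara number modulo the ANNOUNCED [K25] clause
# (cell `b2b-bsdres`, team n1011, seat p03, OWNERS row T-a2-REC; kernel tool of the per-pair records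
# `Additive/X4ThreeKuriharaCertRecords*.lean`; pattern `Additive/X4ThreeResCertKernel.lean`)

HONEST FRAMING (cell `b2b-bsdres`, run/shared/lean/b2b/bsd-rank1-residual/, verbatim in every
file): the goal of the cell is to DELETE the COMBINATION-SHAPED residual classes of the
Birch–Swinnerton-Dyer formula for ALL analytic-rank `≤ 1` elliptic curves over `ℚ` — "full BSD
formula for every rank `≤ 1` curve in class `C`" assembled STRICTLY from published theorems — so
that the rank-`≤ 1` remainder becomes exactly the CONSTRUCTION-SHAPED classes, which are TYPED
(missing-input `Prop`s), NOT attempted. This is not "finishing BSD". Team n1011 (N10/N11, the X4 ∧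
`p = 3` additive block) is a RESEARCH ROUTE; no claim beyond the stated classes; the label X4 and the
mark of RESIDUAL-MAP §I N11 (LOWER@3) are UNCHANGED; nothing is booked (records are EVIDENCE-grade
CANDIDATES for the director). An ANNOUNCED preprint enters ONLY as an explicitly labelled OPEN
hypothesis: §4–§5 are CONDITIONAL on C.-H. Kim (app. R. Pollack), arXiv:2505.09121v1 (2025, PREPRINT),
FLAG `Kim2025-preprint` (its `p = 3` input, Sakamoto JTNB 36 (2024), is refereed). Theorems only.

## What this file proves (the SHAPE of a Kurihara-certificate record at `3`; team row T-a2-REC)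

A LOWER@3 row of N11 (X4 ∧ `r_an = 0` ∧ surj(3) at `p = 3` with `3 ∣ #Ш_an`) is closed per pair,
MODULO the announced clause, by ONE non-vanishing Kurihara number `δ̃_n^{(k)} mod 3^k` at a cyclic
Kolyvagin level `n ∈ 𝒩_k` (§(η) lattice of cells/n1011/KIM-AT-3-ANATOMY.md: node O6 = [K25] Thm. 1.1
PRIMARY record ⟶ exits `BSDp W 3` / `Typed.MissingLowerBoundAt W 3`). The VALUE `δ̃_n mod 3^k` is
not kernel-computable (periods) and stays an EVIDENCE hypothesis (two engines: team E2-AT3); every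
OTHER binder of the chain is turned here into something the kernel or a published table supplies:

* §1 `natCard_nsmul_eq_zero_le_of_not_sq_dvd_card` — in a finite abelian group `G` with `p² ∤ #G`
  there are at most `p` elements killed by `p` (the `p`-torsion is a `p`-group whose order divides
  `#G`); hence `card_torsion_le_of_intModel_of_card`: the CYCLICITY binder `#Ẽ(𝔽_ℓ)[3] ≤ 3` of Kim's
  levels from a kernel point count `#(E₀ mod ℓ)(𝔽_ℓ) = n_ℓ` with `9 ∤ n_ℓ`.
* §2 `isKolyvaginPrime_of_intModel_of_card` — `ℓ ∈ 𝒫_k(E, p)` from: `ℓ` prime, `ℓ ≠ p`, `ℓ ∤ Δ(E₀)`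
  (good reduction, so `ℓ ∤ N`), `ℓ ≡ 1 (mod p^k)` and a kernel point count with `p^k ∣ n_ℓ`
  (`a_ℓ = ℓ + 1 − n_ℓ`); `isKolyvaginProduct_mul` — `ℓ₁ℓ₂ ∈ 𝒩_k` for two distinct such primes;
  `forall_card_torsion_le_of_pair` — cyclicity at both.
* §3 `kuriharaUnitAt_of_level` / `kuriharaIndexLeAt_of_level` — packaging a level with its
  certificates and the EVIDENCE hypothesis `∃ ψ (surjective discrete logs), kuriharaNumber f (3^k) n ψ ≠ 0`
  (independent of `ψ` up to a unit, `exists_units_kuriharaNumber_eq_mul`) into additive-p3's typed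
  input `X4.KuriharaUnitAt W 3 f` (k = 1) / p03's certificate predicate `KuriharaIndexLeAt W 3 f m`.
* §4 **the unit-row record shape** `X4RankZero.bsdp_three_of_intModel_of_optimal_of_kuriharaUnitAt`:
  `Addv W 3` read off the integer model (`3 ∣ Δ`, `3 ∣ c₄`), the `3`-adic TOWER (in records a kernel
  Frobenius certificate), `r_an = 0`, `3 ∤ ∏ c_ℓ`, an OPTIMAL datum `D` at level `N ≤ 130000` (so
  `3 ∤ c_D`, Agashe–Ribet–Stein Thm. 2.6 `h26`, and the period transfer `X4.periodTransfer_of_optimal`),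
  the `Ω⁺_f`-integrality binder `hint` (row T-R18b) and ONE unit Kurihara number of `D.f` ⟹
  `BSDp W 3 ∧ MissingPPartAt W 3`, CONDITIONAL on the PRIMARY record `hK25s` (p09's
  `X4RankZero.bsdp_of_integralPeriod_OPEN_of_kuriharaUnitAt` ∘ `cor17_unit_OPEN_of_thm11_OPEN`); the
  int-free variant through the FLAGGED Ω(W)/Manin second record `hKim25u` beside it. No Kato /
  Delbourgo fact is used on unit rows: the unit clause gives BOTH halves.
* §5 **the Tamagawa-defect record shape** (rows with `3 ∣ ∏ c_ℓ`, level `k ≤ ord₃ ∏ c_ℓ + 1`):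
  the LOWER half from a level-`k` certificate (additive-p4's
  `missingLowerBoundAt_iff_kimTamagawaDefectLeAt_of_kim2025_OPEN` + p03's
  `kimTamagawaDefectLeAt_iff_kuriharaIndexLeAt`), and `BSD(E,3)` from it plus the UPPER half of the
  cell's chain of record on the COVERED LOCUS `hcov` (five named facts; A161 flag
  `Kato-14.5(3)-14.16(2)-additive-potgood-reading-sharp` on the potentially good branch).

What is NOT changed: class X4 stays CONSTRUCTION-SHAPED; N11's mark is unchanged; every record is
CONDITIONAL on the preprint and carries its per-pair EVIDENCE binders; nothing is booked.

References: C.-H. Kim (app. R. Pollack), arXiv:2505.09121v1 (2025, PREPRINT) Thm. 1.1, Cor. 1.7, App. §8.1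
[Kim2025RefinedTNC]; C.-H. Kim, AJM 148 (2026) §1.2.2, §1.4.3, §1.5.1, Thm. 1.10 [Kim2022StructureSelmer];
R. Sakamoto, JTNB 36 (2024) [Sakamoto2024KolyvaginThree]; Agashe–Ribet–Stein 2006 Thm. 2.6
[AgasheRibetStein2006]; Silverman *AEC* VII.5.1, VIII.11 [SilvermanAEC2009]; Kato 2004 Thm. 14.5 (3)
[Kato2004Asterisque]; Miller 2011 Def. 1.1 [Miller2011LMS]; cell files cells/n1011/OWNERS.md (T-a2-REC),
cells/n1011/PREDICTIONS-E2-AT3.md, cells/n1011/KIM-AT-3-ANATOMY.md §(η).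
-/

noncomputable section

open scoped Classical MatrixGroups ModularForm

open CongruenceSubgroup WeierstrassCurve Literature.NumberTheory.EllipticCurves
  Literature.NumberTheory.EllipticCurves.ModularForms
  Literature.NumberTheory.EllipticCurves.Rank1Residual
  Literature.NumberTheory.EllipticCurves.Rank1Residual.Typed
  Literature.NumberTheory.EllipticCurves.AgasheRibetStein2006
  Summit.BirchSwinnertonDyer.BirchSwinnertonDyer.Rank1Residual.IntModel
  Summit.BirchSwinnertonDyer.Rank1Residual.GaloisImage

namespace Summit.BirchSwinnertonDyer.Rank1Residual.Additive

open Summit.BirchSwinnertonDyer.Rank1Residual.X4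

/-! ### §1 Cyclicity of the `p`-torsion from a point count -/

section Cyclicity

/-- **In a finite abelian group `G` with `p² ∤ #G`, at most `p` elements are killed by `p`**: the
`p`-torsion `G[p]` is a `p`-group, so `#G[p] = p^n ∣ #G` (Lagrange) forces `n ≤ 1`. With `G = Ẽ(𝔽_ℓ)`:
the cyclicity binder of Kim's Kolyvagin levels (Kurihara's `𝒫_{1,0}`) follows from `p² ∤ #Ẽ(𝔽_ℓ)`.
[cite: Kim2022StructureSelmer, §1.2.2 and Thm. 1.10 (1) (the cyclic-reduction condition)] -/
theorem natCard_nsmul_eq_zero_le_of_not_sq_dvd_card {G : Type*} [AddCommGroup G] [Finite G]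
    {p : ℕ} [hp : Fact p.Prime] (h : ¬ p ^ 2 ∣ Nat.card G) :
    Nat.card {x : G // p • x = 0} ≤ p := by
  set H : AddSubgroup G := AddSubgroup.torsionBy G p with hH
  have hmem : ∀ x : G, p • x = 0 ↔ x ∈ H := fun x => AddSubgroup.torsionBy.nsmul_iff.symm
  have hcardH : Nat.card {x : G // p • x = 0} = Nat.card H :=
    Nat.card_congr (Equiv.subtypeEquivRight hmem)
  rw [hcardH]
  have hP : IsPGroup p (Multiplicative H) := by
    intro g
    refine ⟨1, ?_⟩
    apply Multiplicative.toAdd.injective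
    rw [pow_one, toAdd_pow, toAdd_one]
    exact AddSubgroup.torsionBy.nsmul (Multiplicative.toAdd g)
  haveI : Finite (Multiplicative H) := Finite.of_equiv H Multiplicative.ofAdd
  obtain ⟨n, hn⟩ := IsPGroup.iff_card.mp hP
  have hn' : Nat.card H = p ^ n := by rw [← hn]; exact Nat.card_congr Multiplicative.ofAdd
  have hdvd : Nat.card H ∣ Nat.card G := AddSubgroup.card_addSubgroup_dvd_card H
  rw [hn'] at hdvd ⊢
  have hn1 : n ≤ 1 := by
    by_contra hlt
    exact h (dvd_trans (pow_dvd_pow p (by omega)) hdvd)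
  calc p ^ n ≤ p ^ 1 := Nat.pow_le_pow_right hp.out.pos hn1
    _ = p := pow_one p

/-- **The cyclicity binder READ OFF AN INTEGER MODEL from a point count**: `integralModelInt W = E₀`
and a kernel point count `#(E₀ mod ℓ)(𝔽_ℓ) = n_ℓ` with `p² ∤ n_ℓ` give `#Ẽ(𝔽_ℓ)[p] ≤ p` in the exact
shape of the Kim facts / `X4.KuriharaUnitAt`. At `p = 3`: `9 ∤ n_ℓ`. [cite: Kim2022StructureSelmer, §1.2.2 and Thm. 1.10 (1)] -/
theorem card_torsion_le_of_intModel_of_card {W : WeierstrassCurve ℚ} [W.IsGloballyMinimal]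
    {E₀ : WeierstrassCurve ℤ} (hI : integralModelInt W = E₀) (p ℓ : ℕ) [Fact p.Prime] [Fact ℓ.Prime]
    {nℓ : ℕ} (hc : Nat.card ((E₀.map (Int.castRingHom (ZMod ℓ))).toAffine.Point) = nℓ)
    (hsq : ¬ p ^ 2 ∣ nℓ) :
    Nat.card {P : ((WeierstrassCurve.integralModelInt W).map
        (Int.castRingHom (ZMod ℓ))).toAffine.Point // p • P = 0} ≤ p := by
  subst hI
  haveI : Finite (((WeierstrassCurve.integralModelInt W).map
      (Int.castRingHom (ZMod ℓ))).toAffine.Point) :=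
    Nat.finite_of_card_ne_zero (by rw [hc]; rintro rfl; exact hsq (dvd_zero _))
  exact natCard_nsmul_eq_zero_le_of_not_sq_dvd_card (by rwa [hc])

end Cyclicity

/-! ### §2 Kolyvagin primes and levels from point counts -/

section Kolyvagin

variable {W : WeierstrassCurve ℚ} [W.IsElliptic] [W.IsGloballyMinimal] {E₀ : WeierstrassCurve ℤ}
  (hI : integralModelInt W = E₀)
include hI

/-- **`ℓ ∈ 𝒫_k(E, p)` READ OFF AN INTEGER MODEL**: `ℓ` prime, `ℓ ≠ p`, `ℓ ∤ Δ(E₀)` (good reduction,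
hence `ℓ ∤ N_E`), `ℓ ≡ 1 (mod p^k)`, and a kernel point count `#(E₀ mod ℓ)(𝔽_ℓ) = n_ℓ` with `p^k ∣ n_ℓ`
(`a_ℓ = ℓ + 1 − n_ℓ ≡ ℓ + 1 (mod p^k)`). [cite: Kim2022StructureSelmer, §1.2.2 (PDF p. 4)] -/
theorem isKolyvaginPrime_of_intModel_of_card (p k ℓ : ℕ) [hp : Fact p.Prime] [hℓ : Fact ℓ.Prime]
    (hℓp : ℓ ≠ p) (hΔ : ¬ (ℓ : ℤ) ∣ E₀.Δ) (h1 : ℓ ≡ 1 [MOD p ^ k]) {nℓ : ℕ}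
    (hc : Nat.card ((E₀.map (Int.castRingHom (ZMod ℓ))).toAffine.Point) = nℓ) (hdvd : p ^ k ∣ nℓ) :
    Kato.IsKolyvaginPrime W p k ℓ := by
  have hgood : W.HasGoodReductionAtPrime ℓ :=
    hasGoodReductionAtPrime_of_not_dvd W ℓ (by rw [minimalDiscriminantInt_eq hI]; exact hΔ)
  refine Kato.isKolyvaginPrime_of_pow_dvd_reductionPointCount hℓ.out ?_ h1 ?_
  · intro h
    rcases (Nat.Prime.dvd_mul hℓ.out).mp h with hN | hp'
    · exact not_dvd_conductorNorm_of_hasGoodReductionAtPrime W hgood hN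
    · exact hℓp ((Nat.prime_dvd_prime_iff_eq hℓ.out hp.out).mp hp')
  · rw [reductionPointCount_eq_of_intModel hI, hc]; exact hdvd

omit hI [W.IsElliptic] in
/-- **`ℓ₁ℓ₂ ∈ 𝒩_k(E, p)` for two distinct Kolyvagin primes.** [cite: Kim2022StructureSelmer, §1.2.2 (PDF p. 4)] -/
theorem isKolyvaginProduct_mul {p k ℓ₁ ℓ₂ : ℕ} (h₁ : Kato.IsKolyvaginPrime W p k ℓ₁)
    (h₂ : Kato.IsKolyvaginPrime W p k ℓ₂) (hne : ℓ₁ ≠ ℓ₂) :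
    Kato.IsKolyvaginProduct W p k (ℓ₁ * ℓ₂) := by
  refine ⟨?_, fun ℓ hℓ => ?_⟩
  · exact Nat.squarefree_mul_iff.mpr ⟨(Nat.coprime_primes h₁.prime h₂.prime).mpr hne,
      Irreducible.squarefree h₁.prime, Irreducible.squarefree h₂.prime⟩
  · obtain ⟨hℓ', hdvd, -⟩ := Nat.mem_primeFactors.mp hℓ
    rcases (Nat.Prime.dvd_mul hℓ').mp hdvd with hd | hd
    · rw [(Nat.prime_dvd_prime_iff_eq hℓ' h₁.prime).mp hd]; exact h₁
    · rw [(Nat.prime_dvd_prime_iff_eq hℓ' h₂.prime).mp hd]; exact h₂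

omit [W.IsElliptic] in
/-- **Cyclicity at every prime factor of `ℓ₁ℓ₂`** from the two point counts (`p² ∤ n_{ℓᵢ}`).
[cite: Kim2022StructureSelmer, §1.2.2 and Thm. 1.10 (1)] -/
theorem forall_card_torsion_le_of_pair (p ℓ₁ ℓ₂ : ℕ) [Fact p.Prime] [Fact ℓ₁.Prime] [Fact ℓ₂.Prime]
    {n₁ n₂ : ℕ} (hc₁ : Nat.card ((E₀.map (Int.castRingHom (ZMod ℓ₁))).toAffine.Point) = n₁)
    (hc₂ : Nat.card ((E₀.map (Int.castRingHom (ZMod ℓ₂))).toAffine.Point) = n₂)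
    (hsq₁ : ¬ p ^ 2 ∣ n₁) (hsq₂ : ¬ p ^ 2 ∣ n₂) :
    ∀ (ℓ : ℕ) [Fact ℓ.Prime], ℓ ∣ ℓ₁ * ℓ₂ →
      Nat.card {P : ((WeierstrassCurve.integralModelInt W).map
          (Int.castRingHom (ZMod ℓ))).toAffine.Point // p • P = 0} ≤ p := by
  intro ℓ hℓ hdvd
  rcases (Nat.Prime.dvd_mul hℓ.out).mp hdvd with hd | hd
  · obtain rfl := (Nat.prime_dvd_prime_iff_eq hℓ.out Fact.out).mp hd
    exact card_torsion_le_of_intModel_of_card hI p ℓ hc₁ hsq₁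
  · obtain rfl := (Nat.prime_dvd_prime_iff_eq hℓ.out Fact.out).mp hd
    exact card_torsion_le_of_intModel_of_card hI p ℓ hc₂ hsq₂

end Kolyvagin

/-! ### §3 Packaging a certified level with the EVIDENCE value into the typed inputs -/

section Packaging

variable {W : WeierstrassCurve ℚ} [W.IsGloballyMinimal] (p : ℕ) {N : ℕ} [NeZero N]
  (f : CuspForm (Gamma0 N) 2)

/-- **`X4.KuriharaUnitAt W p f` from a certified cyclic level `n ∈ 𝒩₁` and the EVIDENCE value
`δ̃_n ≢ 0 (mod p)`** (for some — equivalently every — family of surjective discrete logarithms).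
[cite: Kim2022StructureSelmer, Thm. 1.10 (1) and §1.4.3 (PDF pp. 7–8)] -/
theorem kuriharaUnitAt_of_level (n : ℕ) [NeZero n] (hn : Kato.IsKolyvaginProduct W p 1 n)
    (hcyc : ∀ (ℓ : ℕ) [Fact ℓ.Prime], ℓ ∣ n →
      Nat.card {P : ((WeierstrassCurve.integralModelInt W).map
          (Int.castRingHom (ZMod ℓ))).toAffine.Point // p • P = 0} ≤ p)
    (hδ : ∃ ψ : (ℓ : ℕ) → (ZMod ℓ)ˣ →* Multiplicative (ZMod (p ^ 1)),
      (∀ ℓ ∈ n.primeFactors, Function.Surjective (ψ ℓ)) ∧ kuriharaNumber f (p ^ 1) n ψ ≠ 0) :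
    X4.KuriharaUnitAt W p f :=
  ⟨n, inferInstance, hn, hcyc, hδ⟩

/-- **`KuriharaIndexLeAt W p f m` (p03, `X4SharpThreeKimRefined.lean`) from a certified cyclic level
`n ∈ 𝒩_k`, `1 ≤ k ≤ m + 1`, and the EVIDENCE value `δ̃_n^{(k)} ≢ 0 (mod p^k)`** — the Tamagawa-defect
certificate (Kim–Pollack App. §8.1.2 reads `20787.e1` at level `𝒩₂`).
[cite: Kim2022StructureSelmer, §1.5.1 (PDF p. 7), Conj. 1.10] [cite: Kim2025RefinedTNC, App. §8.1.2 (ANNOUNCED preprint — the example, not a source of truth)] -/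
theorem kuriharaIndexLeAt_of_level (m k n : ℕ) [NeZero n] (hk : 1 ≤ k) (hkm : k ≤ m + 1)
    (hn : Kato.IsKolyvaginProduct W p k n)
    (hcyc : ∀ (ℓ : ℕ) [Fact ℓ.Prime], ℓ ∣ n →
      Nat.card {P : ((WeierstrassCurve.integralModelInt W).map
          (Int.castRingHom (ZMod ℓ))).toAffine.Point // p • P = 0} ≤ p)
    (hδ : ∃ ψ : (ℓ : ℕ) → (ZMod ℓ)ˣ →* Multiplicative (ZMod (p ^ k)),
      (∀ ℓ ∈ n.primeFactors, Function.Surjective (ψ ℓ)) ∧ kuriharaNumber f (p ^ k) n ψ ≠ 0) :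
    KuriharaIndexLeAt W p f m :=
  ⟨k, n, inferInstance, hk, hkm, hn, hcyc, hδ⟩

end Packaging

/-! ### §4 The unit-row record shape: `BSD(E,3)` from ONE unit Kurihara number, modulo [K25] -/

section UnitRow

variable (W : WeierstrassCurve ℚ) [W.IsElliptic] [W.IsGloballyMinimal]

/-- **T-a2-REC, unit-row shape (PRIMARY record).** Globally minimal elliptic `W/ℚ`, integer model
`E₀` with `3 ∣ Δ(E₀)`, `3 ∣ c₄(E₀)` (ADDITIVE at `3`); the `3`-adic tower onto (large image; class X4);
`r_an = 0`; `3 ∤ ∏_ℓ c_ℓ`; an OPTIMAL datum `D` at level `N ≤ 130000` (`Λ_E = c_D Λ_{D.f}`, so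
`3 ∤ c_D` by `h26` and `Ω(W) = |c_D|·Ω⁺_{D.f}`); `Ω⁺_{D.f}`-integral plus symbols (`hint`, row T-R18b);
ONE unit Kurihara number of `D.f` at a cyclic level `n ∈ 𝒩₁(E,3)` ⟹ `BSD(E,3) ∧ MissingPPartAt W 3`,
CONDITIONAL on the announced [K25] Thm. 1.1 PRIMARY record `hK25s`, GZK, modularity — whatever
`ord₃ #Ш_an` is; no Kato / Delbourgo fact used. FLAG `Kim2025-preprint`. Per pair; nothing booked.
[claim: Kim2025RefinedTNC, status: under-review]
[cite: Kim2025RefinedTNC, Thm. 1.1 ("BSD"), Cor. 1.7, App. §8.1.1 (ANNOUNCED preprint — the reason, not a source of truth)]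
[cite: AgasheRibetStein2006, Thm. 2.6 (p. 619)] [cite: SilvermanAEC2009, VII.5 Prop. 5.1 (c)]
[cite: Miller2011LMS, §1 and Def. 1.1] -/
theorem X4RankZero.bsdp_three_of_intModel_of_optimal_of_kuriharaUnitAt
    (hK25s : Kim2025.thm11_kimShaLength_of_integralPeriod_OPEN)
    (hGZK : rank_eq_analyticRank_of_analyticRank_le_one) (hmod : hasEntireLFunction_rat)
    (h26 : cremona_abs_maninConstant_eq_one_of_level_le)
    {E₀ : WeierstrassCurve ℤ} (hI : integralModelInt W = E₀)
    (hΔ : (3 : ℤ) ∣ E₀.Δ) (hc₄ : (3 : ℤ) ∣ E₀.c₄)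
    (htower : ∀ n : ℕ, W.HasSurjectiveModNGaloisRep (3 ^ n : ℕ))
    (hr : W.analyticRank = 0) (htam : ¬ 3 ∣ W.tamagawaProduct)
    {N : ℕ} [NeZero N] (hN : N ≤ 130000) (D : ModularParametrizationData W N)
    (hopt : ∀ z ∈ D.L.lattice, ∃ w ∈ periodLattice D.f, z = D.c * w)
    (hint : ∀ r : ℚ, ratPlusSymbol D.f r ≠ 0 → 0 ≤ padicValRat 3 (ratPlusSymbol D.f r))
    (hK : haveI : Fact (Nat.Prime 3) := ⟨Nat.prime_three⟩; X4.KuriharaUnitAt W 3 D.f) :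
    haveI : Fact (Nat.Prime 3) := ⟨Nat.prime_three⟩
    BSDp W 3 ∧ MissingPPartAt W 3 := by
  haveI : Fact (Nat.Prime 3) := ⟨Nat.prime_three⟩
  have hsurj : W.HasSurjectiveModNGaloisRep 3 := by simpa using htower 1
  have hX : ClassX4 W 3 :=
    ⟨by norm_num, addv_of_intModel hI 3 (by exact_mod_cast hΔ) (by exact_mod_cast hc₄),
      hasIrreducibleModPGaloisRep_of_hasSurjectiveModNGaloisRep W 3 hsurj⟩
  have hc : ¬ (3 : ℤ) ∣ D.maninConstant := not_dvd_maninConstant_of_level_le h26 W D hopt hN Nat.prime_three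
  have hper : ∃ u : ℚ, ‖(u : ℚ_[3])‖ = 1 ∧ W.realPeriodRat = u * plusPeriod D.f :=
    periodTransfer_of_optimal 3 D hopt hc
  have hB : BSDp W 3 :=
    X4RankZero.bsdp_of_integralPeriod_OPEN_of_kuriharaUnitAt W 3 (cor17_unit_OPEN_of_thm11_OPEN hK25s)
      hGZK hmod hr hX htower D.isNewformOf hper hint htam hK
  haveI : Finite W.sha := (hGZK W (by rw [hr]; exact zero_le_one)).2
  exact ⟨hB, missingPPartAt_of_bsdp W 3 hB⟩

/-- **T-a2-REC, unit-row shape through the FLAGGED second record** `hKim25u` (Ω(W)/Manin shape; flags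
`Kim2025-preprint`, `Kim2025-OmegaE-integrality`): the same record WITHOUT the `hint` binder, through
p09's `X4RankZero.bsdp_of_kim2025_OPEN_of_kuriharaUnitAt`; the registry counts the primary shape.
[claim: Kim2025RefinedTNC, status: under-review]
[cite: Kim2025RefinedTNC, Thm. 1.1 ("BSD"), Cor. 1.7 (ANNOUNCED preprint — the reason, not a source of truth)]
[cite: AgasheRibetStein2006, Thm. 2.6 (p. 619)] [cite: Miller2011LMS, §1 and Def. 1.1] -/
theorem X4RankZero.bsdp_three_of_intModel_of_optimal_of_kuriharaUnitAt_of_kim2025_OPEN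
    (hKim25u : Kim2025.rankZero_padicValRat_sha_of_kuriharaNumber_ne_zero_of_towerSurj_OPEN)
    (hGZK : rank_eq_analyticRank_of_analyticRank_le_one) (hmod : hasEntireLFunction_rat)
    (h26 : cremona_abs_maninConstant_eq_one_of_level_le)
    {E₀ : WeierstrassCurve ℤ} (hI : integralModelInt W = E₀)
    (hΔ : (3 : ℤ) ∣ E₀.Δ) (hc₄ : (3 : ℤ) ∣ E₀.c₄)
    (htower : ∀ n : ℕ, W.HasSurjectiveModNGaloisRep (3 ^ n : ℕ))
    (hr : W.analyticRank = 0) (htam : ¬ 3 ∣ W.tamagawaProduct)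
    {N : ℕ} [NeZero N] (hN : N ≤ 130000) (D : ModularParametrizationData W N)
    (hopt : ∀ z ∈ D.L.lattice, ∃ w ∈ periodLattice D.f, z = D.c * w)
    (hK : haveI : Fact (Nat.Prime 3) := ⟨Nat.prime_three⟩; X4.KuriharaUnitAt W 3 D.f) :
    haveI : Fact (Nat.Prime 3) := ⟨Nat.prime_three⟩
    BSDp W 3 ∧ MissingPPartAt W 3 := by
  haveI : Fact (Nat.Prime 3) := ⟨Nat.prime_three⟩
  have hsurj : W.HasSurjectiveModNGaloisRep 3 := by simpa using htower 1
  have hX : ClassX4 W 3 :=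
    ⟨by norm_num, addv_of_intModel hI 3 (by exact_mod_cast hΔ) (by exact_mod_cast hc₄),
      hasIrreducibleModPGaloisRep_of_hasSurjectiveModNGaloisRep W 3 hsurj⟩
  have hc : ¬ (3 : ℤ) ∣ D.maninConstant := not_dvd_maninConstant_of_level_le h26 W D hopt hN Nat.prime_three
  exact X4RankZero.bsdp_of_kim2025_OPEN_of_kuriharaUnitAt W 3 hKim25u hGZK hmod hr hX htower D hc
    (periodTransfer_of_optimal 3 D hopt hc) htam hK

end UnitRow

/-! ### §5 The Tamagawa-defect record shape: LOWER from a level-`k` certificate; `BSD(E,3)` with the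
covered-locus UPPER half -/

section DefectRow

variable (W : WeierstrassCurve ℚ) [W.IsElliptic] [W.IsGloballyMinimal]

/-- **T-a2-REC, Tamagawa-defect shape, LOWER half (PRIMARY record).** On a `3`-adic tower row with
`r_an = 0` and an OPTIMAL datum `D` at level `N ≤ 130000` with `Ω⁺_{D.f}`-integral symbols, a certificate
`KuriharaIndexLeAt W 3 D.f (ord₃ ∏ c_ℓ)` (cyclic `n ∈ 𝒩_k`, `k ≤ ord₃ ∏ c_ℓ + 1`, `δ̃_n^{(k)} ≢ 0 (mod 3^k)`)
gives `Typed.MissingLowerBoundAt W 3`, CONDITIONAL on `hK25s` (additive-p4's LOWER ⟺ `∂^{(∞)} ≤ ord₃ ∏c`,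
p03's `kimTamagawaDefectLeAt_iff_kuriharaIndexLeAt`). FLAG `Kim2025-preprint`. Per pair; nothing booked.
[claim: Kim2025RefinedTNC, status: under-review]
[cite: Kim2025RefinedTNC, Thm. 1.1 ("BSD"), App. §8.1.2 (ANNOUNCED preprint — the reason, not a source of truth)]
[cite: Kim2022StructureSelmer, Conj. 1.10 and §1.5.1 (PDF pp. 7–8)] [cite: AgasheRibetStein2006, Thm. 2.6 (p. 619)] -/
theorem X4RankZero.missingLowerBoundAt_three_of_optimal_of_kuriharaIndexLeAt
    (hK25s : Kim2025.thm11_kimShaLength_of_integralPeriod_OPEN)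
    (hGZK : rank_eq_analyticRank_of_analyticRank_le_one) (hmod : hasEntireLFunction_rat)
    (h26 : cremona_abs_maninConstant_eq_one_of_level_le)
    (htower : ∀ n : ℕ, W.HasSurjectiveModNGaloisRep (3 ^ n : ℕ)) (hr : W.analyticRank = 0)
    {N : ℕ} [NeZero N] (hN : N ≤ 130000) (D : ModularParametrizationData W N)
    (hopt : ∀ z ∈ D.L.lattice, ∃ w ∈ periodLattice D.f, z = D.c * w)
    (hint : ∀ r : ℚ, ratPlusSymbol D.f r ≠ 0 → 0 ≤ padicValRat 3 (ratPlusSymbol D.f r))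
    (hK : haveI : Fact (Nat.Prime 3) := ⟨Nat.prime_three⟩;
      KuriharaIndexLeAt W 3 D.f (padicValNat 3 W.tamagawaProduct)) :
    haveI : Fact (Nat.Prime 3) := ⟨Nat.prime_three⟩
    MissingLowerBoundAt W 3 := by
  haveI : Fact (Nat.Prime 3) := ⟨Nat.prime_three⟩
  have hc : ¬ (3 : ℤ) ∣ D.maninConstant := not_dvd_maninConstant_of_level_le h26 W D hopt hN Nat.prime_three
  have hper : ∃ u : ℚ, ‖(u : ℚ_[3])‖ = 1 ∧ W.realPeriodRat = u * plusPeriod D.f :=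
    periodTransfer_of_optimal 3 D hopt hc
  exact (missingLowerBoundAt_iff_kimTamagawaDefectLeAt_of_kim2025_OPEN W 3 hK25s hGZK hmod le_rfl hr
    htower D hper hint).mpr ((kimTamagawaDefectLeAt_iff_kuriharaIndexLeAt W 3 D.f).mpr hK)

/-- **T-a2-REC, Tamagawa-defect shape, `BSD(E,3)`**: the LOWER half above plus the UPPER half of the
chain of record on the COVERED LOCUS (`X4RankZero.missingUpperBoundAt_of_facts`: `ord₃ j < 0` — Delbourgo
`hDel`, `hmodD`, Wuthrich L. 20 `hL20`, Kato half-eigen `hKatoχ` — ∨ tower ∧ `ord₃ ∏ c_ℓ = ord₃ c₃` ∧ Manin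
datum — sharp Kato A161 `hKatoS`, FLAG `Kato-14.5(3)-14.16(2)-additive-potgood-reading-sharp`), `Addv`
read off the integer model. CONDITIONAL on `hK25s` (FLAG `Kim2025-preprint`). Per pair; nothing booked.
[claim: Kim2025RefinedTNC, status: under-review]
[cite: Kim2025RefinedTNC, Thm. 1.1 ("BSD"), App. §8.1.2 (ANNOUNCED preprint — the reason, not a source of truth)]
[cite: Kato2004Asterisque, Thm. 14.5 (3) (p. 236), Prop. 14.16 (2) (p. 244)]
[cite: AgasheRibetStein2006, Thm. 2.6 (p. 619)] [cite: Miller2011LMS, §1 and Def. 1.1] -/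
theorem X4RankZero.bsdp_three_of_optimal_of_kuriharaIndexLeAt_of_cov
    (hK25s : Kim2025.thm11_kimShaLength_of_integralPeriod_OPEN)
    (hKatoS : Kato2004.rankZero_padicValNat_sha_le_sub_localTamagawa_of_additive_potGood_of_imageContainsSL2)
    (hDel : Delbourgo1998.prop4_rankZero_pow_dvd_constantCoeff)
    (hGZK : rank_eq_analyticRank_of_analyticRank_le_one) (hmod : hasEntireLFunction_rat)
    (hmodD : nonempty_modularParametrizationData)
    (hL20 : Wuthrich2014.lemma20_surjective_threeAdic_of_semistable)
    (hKatoχ : Wuthrich2014.kato_halfEigenCharIdeal_dvd_cyclotomicPrime_of_surjective)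
    (h26 : cremona_abs_maninConstant_eq_one_of_level_le)
    {E₀ : WeierstrassCurve ℤ} (hI : integralModelInt W = E₀)
    (hΔ : (3 : ℤ) ∣ E₀.Δ) (hc₄ : (3 : ℤ) ∣ E₀.c₄)
    (htower : ∀ n : ℕ, W.HasSurjectiveModNGaloisRep (3 ^ n : ℕ)) (hr : W.analyticRank = 0)
    (hcov : padicValRat 3 W.j < 0 ∨
      padicValNat 3 W.tamagawaProduct =
        padicValNat 3 ((W.baseChange ℚ_[3]).localTamagawaNumber ℤ_[3]))
    {N : ℕ} [NeZero N] (hN : N ≤ 130000) (D : ModularParametrizationData W N)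
    (hopt : ∀ z ∈ D.L.lattice, ∃ w ∈ periodLattice D.f, z = D.c * w)
    (hint : ∀ r : ℚ, ratPlusSymbol D.f r ≠ 0 → 0 ≤ padicValRat 3 (ratPlusSymbol D.f r))
    (hK : haveI : Fact (Nat.Prime 3) := ⟨Nat.prime_three⟩;
      KuriharaIndexLeAt W 3 D.f (padicValNat 3 W.tamagawaProduct)) :
    haveI : Fact (Nat.Prime 3) := ⟨Nat.prime_three⟩
    BSDp W 3 := by
  haveI : Fact (Nat.Prime 3) := ⟨Nat.prime_three⟩
  have hsurj : W.HasSurjectiveModNGaloisRep 3 := by simpa using htower 1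
  have hX : ClassX4 W 3 :=
    ⟨by norm_num, addv_of_intModel hI 3 (by exact_mod_cast hΔ) (by exact_mod_cast hc₄),
      hasIrreducibleModPGaloisRep_of_hasSurjectiveModNGaloisRep W 3 hsurj⟩
  have hc : ¬ (3 : ℤ) ∣ D.maninConstant := not_dvd_maninConstant_of_level_le h26 W D hopt hN Nat.prime_three
  have hcov' : padicValRat 3 W.j < 0 ∨
      ((∀ n : ℕ, W.HasSurjectiveModNGaloisRep (3 ^ n : ℕ)) ∧
        padicValNat 3 W.tamagawaProduct =
          padicValNat 3 ((W.baseChange ℚ_[3]).localTamagawaNumber ℤ_[3]) ∧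
        ∃ (N : ℕ) (_ : NeZero N) (D : ModularParametrizationData W N), ¬ (3 : ℤ) ∣ D.maninConstant) :=
    hcov.imp_right fun ht => ⟨htower, ht, N, inferInstance, D, hc⟩
  exact bsdp_of_missingPPartAt W 3 hGZK (by rw [hr]; exact zero_le_one)
    (missingPPartAt_of_lower_of_upper W 3
      (X4RankZero.missingLowerBoundAt_three_of_optimal_of_kuriharaIndexLeAt W hK25s hGZK hmod h26 htower
        hr hN D hopt hint hK)
      (X4RankZero.missingUpperBoundAt_of_facts W 3 hKatoS hDel hGZK hmod hmodD hL20 hKatoχ hr hX hsurj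
        hcov'))

end DefectRow

end Summit.BirchSwinnertonDyer.Rank1Residual.Additive

end
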